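import Literature.NumberTheory.EllipticCurves.SelmerTorsionTwistRestriction
import HarnessLib

/-!
# Route `GenusKolyvaginAtTwo`, LINE 6, KEY crux Q3 (inner statement of stmt-BirchSwinnertonDyer-22137):
# the LOCAL conditions of the `−` factor — `torsionLocalKer` and `selmerLocalKer` correspond under
# the `K`-level twist isomorphism `hPsiKT : H¹(K, E^{(c)}_K[n]) ≃ H¹(K, E_K[n])`

Helper (seat `bsd-line-gk2-p3` g12; `--supports` the crux, closes nothing). In the pair descent of LINE 6 the
classes of sign `−` live on the twin `E^{(c)}` over `ℚ` (this lineage's `…EigenClassesFinite`: `hPsiKT (res x') =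
c_M(n)`), while their local conditions at the Kolyvagin primes and the Lemma-4.3 places are proved over `K` for
`E_K` (Q2 `KolyvaginRelationAtTwo`, McCallum Lemma 4.3 / Prop. 4.4). To move them to `E^{(c)}_K` (and then down
to `ℚ` by `…SelmerDescentQuadratic` / `…KolyvaginPrimeDictionary` applied to the curve `E^{(c)}`), one needs that
the `K`-isomorphism `E^{(c)}_K ≅ E_K` respects BOTH local kernels at every `K`-field `E'` (a completion):

* `mem_torsionLocalKer_iff_h1TorsionIso_mem` — for ANY isomorphism of curves `V • W₁ = W₂` over a field `K` and any
  `K`-field `E'`: `s ∈ torsionLocalKer_{E'}(W₁) ↔ h1TorsionIso s ∈ torsionLocalKer_{E'}(W₂)` (the strict condition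
  "`s_v = 0` in `H¹(K_v, E[n])`"; the Selmer-condition twin is the tree's `mem_selmerLocalKer_iff_h1TorsionIso_mem`).
* `mem_torsionLocalKer_iff_hPsiKT_mem`, `mem_selmerLocalKer_iff_hPsiKT_mem` — the same for the twist isomorphism
  `hPsiKT` of `SelmerTorsionTwistRestriction` (a composite of two `h1TorsionIso`), at every `K`-field.

THEOREMS ONLY (no definition, no named fact, no `sorry`, standard axioms). BSD is not proved by any of this.

References: [SilvermanAEC2009] X.§4 (Selmer data are attached to `E/K` up to `K`-isomorphism), X.5 Cor. 5.4;
[McCallumLMS1991] §3 (3), §4; [GrossLMS1991] §5 (5.1).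
-/

set_option autoImplicit false
set_option linter.dupNamespace false -- tree convention: `Summit.BirchSwinnertonDyer.BirchSwinnertonDyer.Theorems` (summit = sub-problem)

noncomputable section

open scoped Classical

universe u

namespace Summit.BirchSwinnertonDyer.BirchSwinnertonDyer.Theorems.GenusExact.EigenClassesFinite

open WeierstrassCurve Field
open Literature.NumberTheory.EllipticCurves Literature.NumberTheory.GaloisRepresentations

/-! ## §1 Isomorphic curves: the strict local kernel corresponds -/

section Iso

variable {K : Type u} [Field K] {W₁ W₂ : WeierstrassCurve K} {V : VariableChange K} (n : ℤ)
  (E' : Type u) [Field E'] [Algebra K E']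

/-- **The strict local kernels of isomorphic curves correspond**: for `V • W₁ = W₂` over `K` and a `K`-field
`E'`, `s ∈ ker (H¹(K, E₁[n]) → H¹(E', E₁[n]))` iff `h1TorsionIso s ∈ ker (H¹(K, E₂[n]) → H¹(E', E₂[n]))`
(`mem_resKer_iff_h1Equiv_mem` on the square `torsionPointsMap ∘ torsionIso = torsionByCongr (twistLocalIso) ∘
torsionPointsMap`, i.e. `pointsMap_twistPointsIso` on `n`-torsion). [cite: SilvermanAEC2009, X.§4] -/
theorem mem_torsionLocalKer_iff_h1TorsionIso_mem (hV : V • W₁ = W₂) (s : galH1Torsion W₁ n) :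
    s ∈ W₁.torsionLocalKer E' n ↔ h1TorsionIso n hV s ∈ W₂.torsionLocalKer E' n :=
  mem_resKer_iff_h1Equiv_mem (resGal (K := K) E') (torsionPointsMap W₁ E' n)
    (torsionPointsMap_smul W₁ E' n) (torsionPointsMap W₂ E' n) (torsionPointsMap_smul W₂ E' n)
    (torsionIso n hV) (torsionIso_smul n hV) (torsionByCongr (twistLocalIso E' hV) n)
    (fun x T ↦ Subtype.ext (by
      rw [coe_torsionByCongr_apply, AddSubgroup.torsionBy.coe_smul, AddSubgroup.torsionBy.coe_smul,
        coe_torsionByCongr_apply, twistLocalIso_smul]))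
    (fun m ↦ Subtype.ext (by
      rw [coe_torsionByCongr_apply, coe_torsionPointsMap, coe_torsionPointsMap, torsionIso,
        coe_torsionByCongr_apply]
      exact pointsMap_twistPointsIso E' hV (m : geomPoints W₁))) s

end Iso

/-! ## §2 The twist isomorphism `hPsiKT` respects both local kernels -/

section Twist

variable (W : WeierstrassCurve ℚ) (K : Type) [Field K] [NumberField K] {θ : K} {c : ℚ}
  (hθ : θ ∉ Set.range (algebraMap ℚ K)) (hc : θ ^ 2 = algebraMap ℚ K c) (n : ℤ)
  (E' : Type) [Field E'] [Algebra K E']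

/-- **`hPsiKT` respects the strict local kernel** at every `K`-field `E'`:
`y ∈ torsionLocalKer_{E'}(E^{(c)}_K) ↔ hPsiKT y ∈ torsionLocalKer_{E'}(E_K)`. [cite: SilvermanAEC2009, X.§4 and X.5 Cor. 5.4] -/
theorem mem_torsionLocalKer_iff_hPsiKT_mem (y : galH1Torsion ((W.quadraticTwist c).baseChange K) n) :
    y ∈ ((W.quadraticTwist c).baseChange K).torsionLocalKer E' n ↔
      hPsiKT W K hθ hc n y ∈ (W.baseChange K).torsionLocalKer E' n := by
  rw [hPsiKT, AddEquiv.trans_apply,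
    mem_torsionLocalKer_iff_h1TorsionIso_mem n E' (twistUntwist_smul_baseChange W hθ hc) y,
    mem_torsionLocalKer_iff_h1TorsionIso_mem n E'
      (map_smul_baseChange_eq_quadraticTwist_one W (sqChange_spec W) (K := K)),
    AddEquiv.apply_symm_apply]

/-- **`hPsiKT` respects the Selmer local condition** at every `K`-field `E'`:
`y ∈ selmerLocalKer_{E'}(E^{(c)}_K) ↔ hPsiKT y ∈ selmerLocalKer_{E'}(E_K)` (the place-by-place form of the
tree's `mem_selmerGroup_iff_hPsiKT_mem`). [cite: SilvermanAEC2009, X.§4 and X.5 Cor. 5.4] -/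
theorem mem_selmerLocalKer_iff_hPsiKT_mem (y : galH1Torsion ((W.quadraticTwist c).baseChange K) n) :
    y ∈ selmerLocalKer ((W.quadraticTwist c).baseChange K) E' n ↔
      hPsiKT W K hθ hc n y ∈ selmerLocalKer (W.baseChange K) E' n := by
  rw [hPsiKT, AddEquiv.trans_apply,
    mem_selmerLocalKer_iff_h1TorsionIso_mem n E' (twistUntwist_smul_baseChange W hθ hc) y,
    mem_selmerLocalKer_iff_h1TorsionIso_mem n E'
      (map_smul_baseChange_eq_quadraticTwist_one W (sqChange_spec W) (K := K)),
    AddEquiv.apply_symm_apply]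

/-- **Multiples**: `c' • y ∈ torsionLocalKer_{E'}(E^{(c)}_K) ↔ c' • hPsiKT y ∈ torsionLocalKer_{E'}(E_K)` — the shape
of the Kolyvagin relation (`2^j • c_M(mℓ)`, `2^j • c_M(m)`). [cite: McCallumLMS1991, §4 Prop. 4.4] -/
theorem zsmul_mem_torsionLocalKer_iff_hPsiKT_mem (y : galH1Torsion ((W.quadraticTwist c).baseChange K) n)
    (c' : ℤ) :
    c' • y ∈ ((W.quadraticTwist c).baseChange K).torsionLocalKer E' n ↔
      c' • hPsiKT W K hθ hc n y ∈ (W.baseChange K).torsionLocalKer E' n := by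
  rw [← map_zsmul]
  exact mem_torsionLocalKer_iff_hPsiKT_mem W K hθ hc n E' (c' • y)

/-- **Multiples, Selmer condition**: `c' • y ∈ selmerLocalKer_{E'}(E^{(c)}_K) ↔ c' • hPsiKT y ∈ selmerLocalKer_{E'}(E_K)`.
[cite: McCallumLMS1991, §4 Prop. 4.4] -/
theorem zsmul_mem_selmerLocalKer_iff_hPsiKT_mem (y : galH1Torsion ((W.quadraticTwist c).baseChange K) n)
    (c' : ℤ) :
    c' • y ∈ selmerLocalKer ((W.quadraticTwist c).baseChange K) E' n ↔
      c' • hPsiKT W K hθ hc n y ∈ selmerLocalKer (W.baseChange K) E' n := by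
  rw [← map_zsmul]
  exact mem_selmerLocalKer_iff_hPsiKT_mem W K hθ hc n E' (c' • y)

end Twist

end Summit.BirchSwinnertonDyer.BirchSwinnertonDyer.Theorems.GenusExact.EigenClassesFinite

end
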